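import Literature.Analysis.FluidPDE.KNSSTypeIRateLiouvilleMild
import Literature.Analysis.FluidPDE.KNSSLiouvilleBridge

/-!
# Route HardyPointSink — crux `NoHardyTypeIAncient`, line `birth`: gluing Oseen-mild windows

Stub `stub_oseenAncientGluing` of the registered skeleton of line `birth` for the crux
`Summit.NavierStokesRegularity.NavierStokesRegularity.Theses.HardyPointSink.NoHardyTypeIAncient`
(item stmt-NavierStokesRegularity-7980).

Let `u` be a bounded ancient mild solution of Navier–Stokes (`ν = 1`) in the tree's duality form
(`IsBoundedAncientMildSolution 1 u`, Koch–Nadirashvili–Seregin–Šverák 2009, §1, (1.3)) with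
a.e.-strongly measurable slices, and suppose that on every window `(a, b) ⊂ (−∞, 0)` the field `u`
has a representative `U_{ab}` (`u(t) = U_{ab}(t)` a.e. in space for a.e. `t ∈ (a, b)`) which is
jointly continuous, bounded, weakly divergence free at every time of the window and solves the
Oseen integral equation `U(t) = e^{(t−s)Δ}U(s) − B¹ₛ(U, U)(t)` pointwise for all `a < s < t < b`
(the bounded mild class of KNSS 2009, §4 (i)). Then the window representatives glue to ONE field
`U` on `(−∞, 0) × ℝ³` with the same four properties for all `s < t < 0`, `u(t) = U(t)` a.e. for
a.e. `t < 0`, and — the point of the stub — on EVERY slice `t < 0` the two fields differ by a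
spatial constant, `u(t) = U(t) + c(t)` a.e. (the parasitic `b(t)` of KNSS 2009, §1: the duality
form sees slices only modulo constants).

Proof.

1. Uniqueness on overlaps: two window representatives are, at a.e. common time, a.e. equal to the
   same slice of `u`, hence equal on that slice (continuous functions, `Continuous.ae_eq_iff_eq`),
   hence equal at every common time (continuity in time at fixed `x`, `Measure.eqOn_open_of_ae_eq`).
2. Nested windows `J_n = (−(n+2), −1/(n+2))` exhaust `(−∞, 0)`; `U(t) := U_{n(t)}(t)` with
   `t ∈ J_{n(t)}` equals `U_n` on `J_n`, so it inherits continuity, weak divergence-freeness and the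
   Oseen identity (for `s < t < 0` work in one window containing both; the Duhamel term only
   integrates over `(s, t)`), exactly as in the tree's `exists_oseenMild_repr_of_typeIBound_lt_top`.
3. The bound `‖u‖ ≤ M` passes to `U`: a.e. in `x` at a.e. `t`, then everywhere by continuity
   (a continuous function `≤ M` a.e. on an open set is `≤ M` on it).
4. `U` is itself a duality-form bounded ancient mild solution (`isBoundedAncientMildSolution_of_oseen`),
   so for a smooth compactly supported divergence-free `φ` both pairings `t ↦ ∫⟪u(t), φ⟫`,
   `t ↦ ∫⟪U(t), φ⟫` are continuous on `(−∞, 0)`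
   (`IsBoundedAncientMildSolution.continuousOn_integral_inner`); they agree a.e., hence everywhere,
   so `u(t) − U(t)` (bounded, weakly divergence free) annihilates the divergence-free tests and is
   a.e. constant (`IsWeaklyDivFree.exists_ae_eq_const_of_norm_le_of_forall_integral_inner_eq_zero`),
   as in the tree's `IsBoundedAncientMildSolution.exists_ae_eq_const_of_ae_restrict`.

References: G. Koch, N. Nadirashvili, G. Seregin, V. Šverák, Acta Math. 203 (2009) =
arXiv:0709.3599, §1 (the ambiguity `b(t)`), §4 (i). [folklore]
-/

open MeasureTheory Set Function Filter TopologicalSpace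
open scoped ENNReal NNReal Topology RealInnerProductSpace

set_option linter.dupNamespace false -- nested layout Summit.<S>.<Sub>, Sub = S (D-0017)

namespace Summit.NavierStokesRegularity.NavierStokesRegularity.Theorems

/-- **A continuous function bounded a.e. is bounded everywhere.** If `f` is continuous on an open
set `O`, the measure charges open sets, and `f ≤ M` almost everywhere on `O`, then `f ≤ M` on `O`
(apply `Measure.eqOn_open_of_ae_eq` to `min (M − f) 0` and `0`). [folklore] -/
theorem oseenAncientGluing_le_of_ae_le_of_continuousOn {X : Type*} [TopologicalSpace X]
    [MeasurableSpace X] {μ : Measure X} [μ.IsOpenPosMeasure] {O : Set X} (hO : IsOpen O)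
    {f : X → ℝ} (hf : ContinuousOn f O) {M : ℝ} (h : ∀ᵐ x ∂(μ.restrict O), f x ≤ M) :
    ∀ x ∈ O, f x ≤ M := by
  intro x hx
  have hg : ContinuousOn (fun y => min (M - f y) 0) O :=
    continuous_min.comp_continuousOn ((continuousOn_const.sub hf).prodMk continuousOn_const)
  have hg0 : (fun y => min (M - f y) 0) =ᵐ[μ.restrict O] fun _ => 0 := by
    filter_upwards [h] with y hy
    exact min_eq_right (sub_nonneg.2 hy)
  have h1 := Measure.eqOn_open_of_ae_eq hg0 hO hg continuousOn_const hx
  have h2 : 0 ≤ M - f x := min_eq_right_iff.1 h1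
  linarith

open Literature.Analysis Literature.Analysis.FluidPDE in
/-- **Stub `stub_oseenAncientGluing` (window representatives glue).** Let `u` be a duality-form
bounded ancient mild solution (`ν = 1`) with a.e.-strongly measurable slices which has, on every
window `(a, b) ⊂ (−∞, 0)`, a jointly continuous bounded representative with weakly divergence-free
slices solving the Oseen integral equation for `a < s < t < b`. Then there is one such
representative `U` on all of `(−∞, 0) × ℝ³` (Oseen identity for all `s < t < 0`), with
`u(t) = U(t)` a.e. for a.e. `t < 0` and `u(t) = U(t) + c(t)` a.e. for EVERY `t < 0`: on overlaps
two continuous representatives agree at a.e. time a.e., hence everywhere; nested windows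
`(−(n+2), −1/(n+2))` exhaust `(−∞, 0)`; the bound of `u` transfers through continuity; and on
every slice `u(t) − U(t)` annihilates the divergence-free tests, both pairings being continuous
in `t` (`IsBoundedAncientMildSolution.continuousOn_integral_inner`,
`isBoundedAncientMildSolution_of_oseen`), so it is a.e. constant
(`IsWeaklyDivFree.exists_ae_eq_const_of_norm_le_of_forall_integral_inner_eq_zero`; the constant is
the ambiguity `b(t)` of KNSS 2009, §1). [folklore] -/
theorem stub_oseenAncientGluing :
    ∀ (u : ℝ → EuclideanSpace ℝ (Fin 3) → EuclideanSpace ℝ (Fin 3)),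
      (∀ t < 0, AEStronglyMeasurable (u t) volume) →
      Literature.Analysis.FluidPDE.IsBoundedAncientMildSolution 1 u →
      (∀ a b : ℝ, a < b → b < 0 →
        ∃ U : ℝ → EuclideanSpace ℝ (Fin 3) → EuclideanSpace ℝ (Fin 3),
          ContinuousOn (uncurry U) (Ioo a b ×ˢ (univ : Set (EuclideanSpace ℝ (Fin 3)))) ∧
          (∃ C : ℝ, ∀ t ∈ Ioo a b, ∀ x, ‖U t x‖ ≤ C) ∧
          (∀ t ∈ Ioo a b, Literature.Analysis.FluidPDE.IsWeaklyDivFree (U t)) ∧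
          (∀ s t : ℝ, a < s → s < t → t < b → ∀ x,
            U t x = Literature.Analysis.UnboundedOperators.heatExtension (U s) (t - s) x -
              Literature.Analysis.FluidPDE.oseenDuhamel 1 s U U t x) ∧
          (∀ᵐ t ∂(volume.restrict (Ioo a b)), u t =ᵐ[volume] U t)) →
      ∃ U : ℝ → EuclideanSpace ℝ (Fin 3) → EuclideanSpace ℝ (Fin 3),
        ContinuousOn (uncurry U) (Iio (0 : ℝ) ×ˢ (univ : Set (EuclideanSpace ℝ (Fin 3)))) ∧
        (∃ C : ℝ, ∀ t < 0, ∀ x, ‖U t x‖ ≤ C) ∧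
        (∀ t < 0, Literature.Analysis.FluidPDE.IsWeaklyDivFree (U t)) ∧
        (∀ s t : ℝ, s < t → t < 0 → ∀ x,
          U t x = Literature.Analysis.UnboundedOperators.heatExtension (U s) (t - s) x -
            Literature.Analysis.FluidPDE.oseenDuhamel 1 s U U t x) ∧
        (∀ᵐ t ∂(volume.restrict (Iio (0 : ℝ))), u t =ᵐ[volume] U t) ∧
        (∀ t < 0, ∃ c : EuclideanSpace ℝ (Fin 3), u t =ᵐ[volume] fun x => U t x + c) := by
  intro u hmeas hu hW
  obtain ⟨M, hM⟩ := hu.2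
  -- ## the windows `J n = (−(n+2), −1/(n+2))`
  set a : ℕ → ℝ := fun n => -((n : ℝ) + 2) with ha
  set c : ℕ → ℝ := fun n => -(1 / ((n : ℝ) + 2)) with hc
  have hc0 : ∀ n, c n < 0 := fun n => by rw [hc]; dsimp only; rw [neg_lt_zero]; positivity
  have hac : ∀ n, a n < c n := fun n => by
    rw [ha, hc]; dsimp only
    have hn : (2 : ℝ) ≤ (n : ℝ) + 2 := by linarith [(Nat.cast_nonneg n : (0 : ℝ) ≤ n)]
    have h1 : 1 / ((n : ℝ) + 2) ≤ 1 / 2 := div_le_div_of_nonneg_left zero_le_one two_pos hn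
    linarith
  have hanti : ∀ {k m : ℕ}, k ≤ m → a m ≤ a k := fun {k m} hkm => by
    rw [ha]; dsimp only
    have : (k : ℝ) ≤ m := by exact_mod_cast hkm
    linarith
  have hcmono : ∀ {k m : ℕ}, k ≤ m → c k ≤ c m := fun {k m} hkm => by
    rw [hc]; dsimp only
    have : (k : ℝ) ≤ m := by exact_mod_cast hkm
    have h1 : 1 / ((m : ℝ) + 2) ≤ 1 / ((k : ℝ) + 2) :=
      div_le_div_of_nonneg_left zero_le_one (by positivity) (by linarith)
    linarith
  have hnest : ∀ {k m : ℕ}, k ≤ m → Ioo (a k) (c k) ⊆ Ioo (a m) (c m) := fun hkm t ht =>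
    ⟨(hanti hkm).trans_lt ht.1, ht.2.trans_le (hcmono hkm)⟩
  -- ## the window representatives
  choose V hVc _hVb hVd hVm hVae using fun n => hW (a n) (c n) (hac n) (hc0 n)
  -- slices and time sections of the representatives are continuous
  have hVsl : ∀ n, ∀ t ∈ Ioo (a n) (c n), Continuous (V n t) := fun n t ht =>
    (hVc n).comp_continuous (f := fun x : EuclideanSpace ℝ (Fin 3) => (t, x)) (by fun_prop)
      fun x => ⟨ht, mem_univ _⟩
  have hVtm : ∀ n x, ContinuousOn (fun t => V n t x) (Ioo (a n) (c n)) := fun n x =>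
    (hVc n).comp (f := fun t : ℝ => (t, x)) (Continuous.continuousOn (by fun_prop))
      fun t ht => ⟨ht, mem_univ _⟩
  -- ## agreement on overlaps
  have hagree : ∀ k n, ∀ t ∈ Ioo (a k) (c k) ∩ Ioo (a n) (c n), V k t = V n t := by
    intro k n
    have hO : IsOpen (Ioo (a k) (c k) ∩ Ioo (a n) (c n)) := isOpen_Ioo.inter isOpen_Ioo
    have hae : ∀ᵐ t ∂(volume.restrict (Ioo (a k) (c k) ∩ Ioo (a n) (c n))), V k t = V n t := by
      have h1 : ∀ᵐ t ∂(volume.restrict (Ioo (a k) (c k) ∩ Ioo (a n) (c n))),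
          u t =ᵐ[volume] V k t :=
        ae_restrict_of_ae_restrict_of_subset inter_subset_left (hVae k)
      have h2 : ∀ᵐ t ∂(volume.restrict (Ioo (a k) (c k) ∩ Ioo (a n) (c n))),
          u t =ᵐ[volume] V n t :=
        ae_restrict_of_ae_restrict_of_subset inter_subset_right (hVae n)
      filter_upwards [h1, h2, ae_restrict_mem hO.measurableSet] with t h1t h2t ht
      exact (Continuous.ae_eq_iff_eq volume (hVsl k t ht.1) (hVsl n t ht.2)).1 (h1t.symm.trans h2t)
    intro t ht
    funext x
    have hae' : (fun s => V k s x) =ᵐ[volume.restrict (Ioo (a k) (c k) ∩ Ioo (a n) (c n))]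
        fun s => V n s x := by
      filter_upwards [hae] with s hs
      rw [hs]
    exact Measure.eqOn_open_of_ae_eq hae' hO ((hVtm k x).mono inter_subset_left)
      ((hVtm n x).mono inter_subset_right) ht
  -- ## the index of a window containing a given negative time
  set idx : ℝ → ℕ := fun t => ⌈-t⌉₊ + ⌈1 / (-t)⌉₊ with hidxdef
  have hidx : ∀ t < 0, t ∈ Ioo (a (idx t)) (c (idx t)) := by
    intro t ht
    have ht0 : 0 < -t := neg_pos.2 ht
    have h1 : -t ≤ (⌈-t⌉₊ : ℝ) := Nat.le_ceil _
    have h2 : 1 / (-t) ≤ (⌈1 / (-t)⌉₊ : ℝ) := Nat.le_ceil _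
    have hk : ((idx t : ℕ) : ℝ) = (⌈-t⌉₊ : ℝ) + ⌈1 / (-t)⌉₊ := by
      rw [hidxdef]; dsimp only; rw [Nat.cast_add]
    have hn1 : (0 : ℝ) ≤ ⌈-t⌉₊ := Nat.cast_nonneg _
    have hn2 : (0 : ℝ) ≤ ⌈1 / (-t)⌉₊ := Nat.cast_nonneg _
    constructor
    · show -(((idx t : ℕ) : ℝ) + 2) < t
      rw [hk]; linarith
    · show t < -(1 / (((idx t : ℕ) : ℝ) + 2))
      rw [hk]
      have hpos : (0 : ℝ) < (⌈-t⌉₊ : ℝ) + ⌈1 / (-t)⌉₊ + 2 := by positivity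
      have hK : 1 / (-t) < (⌈-t⌉₊ : ℝ) + ⌈1 / (-t)⌉₊ + 2 := by linarith
      rw [div_lt_iff₀ ht0] at hK
      rw [lt_neg, div_lt_iff₀ hpos]
      linarith
  -- ## the glued field
  set U : ℝ → EuclideanSpace ℝ (Fin 3) → EuclideanSpace ℝ (Fin 3) := fun t x => V (idx t) t x
    with hUdef
  have hloc : ∀ n, ∀ t ∈ Ioo (a n) (c n), U t = V n t := fun n t ht =>
    hagree (idx t) n t ⟨hidx t (ht.2.trans (hc0 n)), ht⟩
  -- continuity on the open slab
  have hcontU : ContinuousOn (uncurry U) (Iio 0 ×ˢ univ) := by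
    rintro ⟨t, x⟩ ⟨ht, -⟩
    have hWn : Ioo (a (idx t)) (c (idx t)) ×ˢ (univ : Set (EuclideanSpace ℝ (Fin 3))) ∈ 𝓝 (t, x) :=
      (isOpen_Ioo.prod isOpen_univ).mem_nhds ⟨hidx t ht, mem_univ _⟩
    have heq : EqOn (uncurry U) (uncurry (V (idx t)))
        (Ioo (a (idx t)) (c (idx t)) ×ˢ (univ : Set (EuclideanSpace ℝ (Fin 3)))) :=
      fun z hz => congrFun (hloc (idx t) z.1 hz.1) z.2
    exact (((hVc (idx t)).congr heq).continuousAt hWn).continuousWithinAt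
  -- slices
  have hUsl : ∀ t < 0, Continuous (U t) := fun t ht => hVsl (idx t) t (hidx t ht)
  have hUmeas : ∀ t < 0, AEStronglyMeasurable (U t) volume := fun t ht =>
    (hUsl t ht).aestronglyMeasurable
  -- weak divergence-freeness
  have hdivU : ∀ t < 0, IsWeaklyDivFree (U t) := fun t ht => hVd (idx t) t (hidx t ht)
  -- the Oseen identity, inside one window containing `s` and `t`
  have hmildU : ∀ s t : ℝ, s < t → t < 0 → ∀ x,
      U t x = UnboundedOperators.heatExtension (U s) (t - s) x - oseenDuhamel 1 s U U t x := by
    intro s t hst ht x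
    have hs : s < 0 := hst.trans ht
    set m : ℕ := max (idx s) (idx t)
    have hsW : s ∈ Ioo (a m) (c m) := hnest (le_max_left _ _) (hidx s hs)
    have htW : t ∈ Ioo (a m) (c m) := hnest (le_max_right _ _) (hidx t ht)
    have h1 := hVm m s t hsW.1 hst htW.2 x
    have e1 : U t x = V m t x := congrFun (hloc m t htW) x
    have e2 : U s = V m s := hloc m s hsW
    have e3 : oseenDuhamel 1 s U U t x = oseenDuhamel 1 s (V m) (V m) t x := by
      simp only [oseenDuhamel_apply]
      refine setIntegral_congr_fun measurableSet_Ioo fun σ hσ => ?_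
      have hσW : σ ∈ Ioo (a m) (c m) := ⟨hsW.1.trans hσ.1, hσ.2.trans htW.2⟩
      rw [hloc m σ hσW]
    rw [e1, e2, e3]
    exact h1
  -- ## the bound of `u` passes to `U`
  have hbddV : ∀ n, ∀ᵐ t ∂(volume.restrict (Ioo (a n) (c n))), ∀ x, ‖V n t x‖ ≤ M := by
    intro n
    filter_upwards [hVae n, ae_restrict_mem measurableSet_Ioo] with t ht htI
    have hae : ∀ᵐ x ∂((volume : Measure (EuclideanSpace ℝ (Fin 3))).restrict univ),
        ‖V n t x‖ ≤ M := by
      rw [Measure.restrict_univ]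
      filter_upwards [ht] with x hx
      rw [← hx]
      exact hM t (htI.2.trans (hc0 n)) x
    exact fun x => oseenAncientGluing_le_of_ae_le_of_continuousOn isOpen_univ
      (hVsl n t htI).norm.continuousOn hae x (mem_univ x)
  have hbddU : ∀ t < 0, ∀ x, ‖U t x‖ ≤ M := by
    intro t ht x
    have hae : ∀ᵐ s ∂(volume.restrict (Ioo (a (idx t)) (c (idx t)))), ‖V (idx t) s x‖ ≤ M :=
      (hbddV (idx t)).mono fun s hs => hs x
    exact oseenAncientGluing_le_of_ae_le_of_continuousOn isOpen_Ioo (hVtm (idx t) x).norm hae t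
      (hidx t ht)
  -- ## `u = U` a.e. on a.e. slice
  have haeU : ∀ᵐ t ∂(volume.restrict (Iio (0 : ℝ))), u t =ᵐ[volume] U t := by
    have hcover : Iio (0 : ℝ) ⊆ ⋃ n, Ioo (a n) (c n) := fun t ht =>
      mem_iUnion.2 ⟨idx t, hidx t ht⟩
    refine ae_restrict_of_ae_restrict_of_subset hcover ((ae_restrict_iUnion_iff _ _).2 fun n => ?_)
    filter_upwards [hVae n, ae_restrict_mem measurableSet_Ioo] with t ht htI
    rw [hloc n t htI]
    exact ht
  refine ⟨U, hcontU, ⟨M, hbddU⟩, hdivU, hmildU, haeU, fun t₀ ht₀ => ?_⟩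
  -- ## every slice modulo constants
  have hUsol : IsBoundedAncientMildSolution 1 U :=
    isBoundedAncientMildSolution_of_oseen one_pos hcontU ⟨M, hbddU⟩ hdivU
      fun s t hst ht x => by rw [one_mul]; exact hmildU s t hst ht x
  have hwm : AEStronglyMeasurable (fun x => u t₀ x - U t₀ x) volume :=
    (hmeas t₀ ht₀).sub (hUmeas t₀ ht₀)
  have hwb : ∀ x, ‖u t₀ x - U t₀ x‖ ≤ M + M := fun x =>
    (norm_sub_le _ _).trans (add_le_add (hM t₀ ht₀ x) (hbddU t₀ ht₀ x))
  have hwdiv : IsWeaklyDivFree (fun x => u t₀ x - U t₀ x) :=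
    IsWeaklyDivFree.sub_of_locallyIntegrable (hu.1.1 t₀ ht₀) (hdivU t₀ ht₀)
      ((memLp_top_of_bound (hmeas t₀ ht₀) M (Eventually.of_forall (hM t₀ ht₀))).locallyIntegrable
        le_top)
      ((memLp_top_of_bound (hUmeas t₀ ht₀) M
        (Eventually.of_forall (hbddU t₀ ht₀))).locallyIntegrable le_top)
  obtain ⟨c₀, hc₀⟩ :=
    IsWeaklyDivFree.exists_ae_eq_const_of_norm_le_of_forall_integral_inner_eq_zero hwm hwb hwdiv
      fun φ hφ hdφ => by
        -- the pairings of `u` and `U` with `φ` are continuous on `(−∞, 0)` and agree a.e.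
        have hgu : ContinuousOn (fun t => ∫ x, ⟪u t x, φ x⟫) (Iio 0) :=
          hu.continuousOn_integral_inner one_pos hmeas hφ hdφ
        have hgU : ContinuousOn (fun t => ∫ x, ⟪U t x, φ x⟫) (Iio 0) :=
          hUsol.continuousOn_integral_inner one_pos hUmeas hφ hdφ
        have hae : (fun t => ∫ x, ⟪u t x, φ x⟫) =ᵐ[volume.restrict (Iio (0 : ℝ))]
            fun t => ∫ x, ⟪U t x, φ x⟫ := by
          filter_upwards [haeU] with t ht
          refine integral_congr_ae ?_
          filter_upwards [ht] with x hx
          rw [hx]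
        have hpair := Measure.eqOn_open_of_ae_eq hae isOpen_Iio hgu hgU ht₀
        have hφi : Integrable φ :=
          hφ.contDiff.continuous.integrable_of_hasCompactSupport hφ.hasCompactSupport
        have i1 := integrable_inner_of_aestronglyMeasurable_of_norm_le (hmeas t₀ ht₀) (hM t₀ ht₀) hφi
        have i2 :=
          integrable_inner_of_aestronglyMeasurable_of_norm_le (hUmeas t₀ ht₀) (hbddU t₀ ht₀) hφi
        simp_rw [inner_sub_left]
        rw [integral_sub i1 i2, sub_eq_zero]
        exact hpair
  refine ⟨c₀, ?_⟩
  filter_upwards [hc₀] with x hx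
  exact sub_eq_iff_eq_add'.1 hx

end Summit.NavierStokesRegularity.NavierStokesRegularity.Theorems
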